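import Literature.AlgebraicGeometry.Frobenioids.Prop25SubPsiProofs
import Literature.AlgebraicGeometry.Frobenioids.FrobenioidNatIsoTransport
import Literature.AlgebraicGeometry.Frobenioids.FrobenioidMonoidIsoTransport
import Literature.AlgebraicGeometry.Frobenioids.FrobenioidEquivalence
import HarnessLib

/-!
# [FrdI] Proposition 2.5 (iii), sub-DAG row P25-L09 `CdFrobenioid` (the bracket "`C(d)` is a
# Frobenioid", τ-free form) and the assembly P25-L00

Mochizuki, *The geometry of Frobenioids I: the general theory*, Kyushu J. Math. **62** (2008)
293–400, §2, Proposition 2.5 (iii), p. 49 ll. 7–8 [cite: MochizukiFrdI2008, Prop. 2.5(iii) p.49]: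
"(b) `Ψ` is 1-compatible, relative to the functors `C → F_Φ`, `C(d) → F_{d·Φ} = (F_Φ)(d) ⊆ F_Φ` with
the Frobenius functor associated to `d` on `F_Φ` [which implies, in particular, that `C(d)`, equipped
with the natural functor `C(d) → F_{d·Φ}`, is a Frobenioid]."

PROOF-ONLY companion of `Prop25Sub.lean` (abc-iut-L1-t2, p414336), row P25-L09 as typed (slot owner's
ruling KEEP, 2026-08-26): for ANY unit-linear Frobenius datum `U` whose functor `Ψ_U : C → C(d)` is an
equivalence `1`-commuting with the Frobenius functor, `C(d) → F_{d·Φ}` is a Frobenioid.  Route (GAP row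
G-L6t9-1): (1) `C → F_Φ ⥲ F_{d·Φ}` (change of divisor monoid along the isomorphism `d · : Φ ⥲ d·Φ`,
`imageMonoidIso`) is a Frobenioid — `IsFrobenioid.comp_map_of_iso` (abc-iut-w4-d018,
`FrobenioidMonoidIsoTransport.lean`); (2) the `1`-commutativity isomorphism `η` yields an isomorphism of
structure functors `Ψ_U ⋙ (C(d) → F_{d·Φ}) ≅ (C → F_Φ ⥲ F_{d·Φ})` on `C` (`exists_compatIso`: base
components those of `η`, `Div` and `deg_Fr` by the `η`-identities), so `Ψ_U ⋙ (C(d) → F_{d·Φ})` is a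
Frobenioid (`IsFrobenioid.of_natIso`, `FrobenioidNatIsoTransport.lean`); (3) descend along the
equivalence `Ψ_U` (`IsFrobenioid.of_isEquivalence_comp`: precompose with a quasi-inverse —
`IsFrobenioid.comp_of_isEquivalence`, abc-iut-L6-t6 — and remove `Ψ_U⁻¹ ⋙ Ψ_U ≅ id` by `of_natIso`).  The printed clause with `τ` in scope is
`PreFrobenioid.cdIsFrobenioid` (p414682); this file closes the slot `FrdI.P25.CdFrobenioid` BY NAME and
instantiates the typer's assembly `assembly25iii` (row P25-L00).  No new definitions.
-/

namespace Literature.AlgebraicGeometry.Frobenioids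

open CategoryTheory Opposite

universe w v v' v'' u u' u''

namespace PreFrobenioid

variable {D : Type u} [Category.{v} D] {Φ : Dᵒᵖ ⥤ CommMonCat.{w}}
  {C : Type u'} [Category.{v'} C] {C' : Type u''} [Category.{v''} C']

/-- **Descent of the Frobenioid property along an equivalence**: if `K ⋙ F'` is a Frobenioid for an
equivalence of categories `K : C ⥲ C'`, then so is `F' : C' → F_Φ` (precompose with a quasi-inverse —
`IsFrobenioid.comp_of_isEquivalence`, abc-iut-L6-t6 — and remove `K⁻¹ ⋙ K ≅ id` by
`IsFrobenioid.of_natIso`).  The converse of `IsFrobenioid.comp_of_isEquivalence`; FrdI §0 p. 15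
("1-commutes"). [cite: MochizukiFrdI2008, Def. 1.3 p.24] -/
theorem IsFrobenioid.of_isEquivalence_comp (F' : C' ⥤ ElemFrobenioid Φ) (K : C ⥤ C') [K.IsEquivalence]
    (h : IsFrobenioid (K ⋙ F')) : IsFrobenioid F' :=
  IsFrobenioid.of_natIso
    ((Functor.associator _ _ _).symm ≪≫ Functor.isoWhiskerRight K.asEquivalence.counitIso F' ≪≫
      Functor.leftUnitor F')
    (IsFrobenioid.comp_of_isEquivalence K.inv h)

/-- **Transport along a `1`-commutative square**: for an equivalence `K : C ⥲ C'` and structure functors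
with `K ⋙ F' ≅ F`, `F` a Frobenioid ⟹ `F'` a Frobenioid. [cite: MochizukiFrdI2008, Def. 1.3 p.24] -/
theorem IsFrobenioid.of_isEquivalence_of_iso {F : C ⥤ ElemFrobenioid Φ} (F' : C' ⥤ ElemFrobenioid Φ)
    (K : C ⥤ C') [K.IsEquivalence] (e : K ⋙ F' ≅ F) (hF : IsFrobenioid F) : IsFrobenioid F' :=
  IsFrobenioid.of_isEquivalence_comp F' K (IsFrobenioid.of_natIso e.symm hF)

end PreFrobenioid

namespace FrdI.P25

open PreFrobenioid

variable {D : Type u} [Category.{v} D] {Φ : Dᵒᵖ ⥤ CommMonCat.{w}}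
  {C : Type u'} [Category.{v'} C] {F : C ⥤ ElemFrobenioid Φ}

/-! ### The comparison isomorphism on `C` -/

/-- From the `1`-commutativity isomorphism `η : Ψ_U ⋙ (C(d) ⊆ C → F_Φ) ≅ (C → F_Φ) ⋙ Frob_d`: the
`η`-identities `deg_Fr(Ψ φ) = deg_Fr(φ)` and `Div(Ψ φ) = Base(η_A)^* (d · Div φ)` (the components `η_A`
are isomorphisms of `F_Φ`: `Div = 0`, `deg_Fr = 1`). [cite: MochizukiFrdI2008, Prop. 2.5(iii) p.49] -/
theorem degFr_div_of_compat (hP : IsPreFrobenioid Φ F) (d : ℕ+) (U : UnitLinearFrobeniusData F (powEnd Φ d))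
    (η : U.functor ⋙ (wideSubcategoryInclusion (divIn F (powEnd Φ d)) ⋙ F) ≅ F ⋙ ElemFrobenioid.frobenius Φ d)
    {A B : C} (φ : A ⟶ B) :
    degFr F (U.map φ) = degFr F φ ∧
      Div F (U.map φ) = pull Φ (ElemFrobenioid.Base (η.hom.app A) : baseObj F A ⟶ baseObj F A)
        (((powEnd Φ d).app (op (baseObj F A))).hom (Div F φ)) := by
  have hΦ : ∀ X : D, IsSharp (Φ.obj (op X)) := fun X => (hP.isDivisorial X).isSharp
  have nat := η.hom.naturality φ
  have hdegB : ElemFrobenioid.degFr (η.hom.app B) = 1 := ElemFrobenioid.degFr_eq_one_of_isIso (η.app B).hom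
  have hdegA : ElemFrobenioid.degFr (η.hom.app A) = 1 := ElemFrobenioid.degFr_eq_one_of_isIso (η.app A).hom
  have hdivB : (ElemFrobenioid.Div (η.hom.app B) : Φ.obj (op (baseObj F B))) = 1 :=
    ElemFrobenioid.div_eq_one_of_isIso hΦ (η.app B).hom
  have hdivA : (ElemFrobenioid.Div (η.hom.app A) : Φ.obj (op (baseObj F A))) = 1 :=
    ElemFrobenioid.div_eq_one_of_isIso hΦ (η.app A).hom
  constructor
  · have h := congrArg ElemFrobenioid.Hom.degFr nat
    have h' : degFr F (U.map φ) * ElemFrobenioid.degFr (η.hom.app B) =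
        ElemFrobenioid.degFr (η.hom.app A) * degFr F φ := h
    rwa [hdegB, hdegA, mul_one, one_mul] at h'
  · have h := congrArg ElemFrobenioid.Hom.div nat
    have h' : pull Φ (Base F (U.map φ)) (ElemFrobenioid.Div (η.hom.app B) : Φ.obj (op (baseObj F B))) *
        Div F (U.map φ) ^ (ElemFrobenioid.degFr (η.hom.app B) : ℕ) =
      pull Φ (ElemFrobenioid.Base (η.hom.app A) : baseObj F A ⟶ baseObj F A)
          (((powEnd Φ d).app (op (baseObj F A))).hom (Div F φ)) *
        (ElemFrobenioid.Div (η.hom.app A) : Φ.obj (op (baseObj F A))) ^ (degFr F φ : ℕ) := h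
    rwa [hdivB, hdivA, hdegB, map_one, one_mul, one_pow, mul_one, PNat.one_coe, pow_one] at h'

/-- **The comparison isomorphism.** For a unit-linear Frobenius datum `U` with `Ψ_U` `1`-compatible
with the Frobenius functor of degree `d` (isomorphism `η`), the structure functors
`Ψ_U ⋙ (C(d) → F_{d·Φ})` and `(C → F_Φ) ⋙ (F_Φ ⥲ F_{d·Φ})` on `C` are isomorphic: components
`(Base(η_A), 0, 1)`. [cite: MochizukiFrdI2008, Prop. 2.5(iii) p.49] -/
theorem exists_compatIso (hP : IsPreFrobenioid Φ F) (d : ℕ+) (U : UnitLinearFrobeniusData F (powEnd Φ d))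
    (η : U.functor ⋙ (wideSubcategoryInclusion (divIn F (powEnd Φ d)) ⋙ F) ≅ F ⋙ ElemFrobenioid.frobenius Φ d) :
    Nonempty (U.functor ⋙ cdToElem F (powEnd Φ d) ≅
      F ⋙ ElemFrobenioid.map (imageMonoidIso (powEnd Φ d) (powEnd_app_injective hP d)).hom) := by
  refine ⟨NatIso.ofComponents
    (fun A => ElemFrobenioid.isoMk (imageMonoid (powEnd Φ d))
      ((ElemFrobenioid.baseFunctor Φ).mapIso (η.app A))) fun {A B} φ => ?_⟩
  obtain ⟨hdeg, hdiv⟩ := degFr_div_of_compat hP d U η φ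
  have hbase : Base F (U.map φ) ≫ ElemFrobenioid.Base (η.hom.app B) =
      ElemFrobenioid.Base (η.hom.app A) ≫ Base F φ := congrArg ElemFrobenioid.Hom.base (η.hom.naturality φ)
  apply ElemFrobenioid.Hom.ext
  · exact hbase
  · apply Subtype.ext
    show pull Φ (Base F (U.map φ)) (1 : Φ.obj (op (baseObj F B))) * Div F (U.map φ) ^ ((1 : ℕ+) : ℕ) =
      pull Φ (ElemFrobenioid.Base (η.hom.app A) : baseObj F A ⟶ baseObj F A)
          (((powEnd Φ d).app (op (baseObj F A))).hom (Div F φ)) *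
        (1 : Φ.obj (op (baseObj F A))) ^ (degFr F φ : ℕ)
    rw [map_one, one_mul, PNat.one_coe, pow_one, one_pow, mul_one, hdiv]
  · show degFr F (U.map φ) * 1 = 1 * degFr F φ
    rw [mul_one, one_mul, hdeg]

/-! ### `C(d) → F_{d·Φ}` is a Frobenioid -/

/-- **`C(d)` with `C(d) → F_{d·Φ}` is a Frobenioid**, for any unit-linear Frobenius datum `U` whose
functor is an equivalence `1`-commuting with the Frobenius functor of degree `d`, GIVEN that the change
of divisor monoid `C → F_Φ ⥲ F_{d·Φ}` is a Frobenioid (`h3`; supplied by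
`IsFrobenioid.comp_map_of_iso`). [cite: MochizukiFrdI2008, Prop. 2.5(iii) p.49] -/
theorem isFrobenioid_cdToElem_of_compat (hF : IsFrobenioid F) (d : ℕ+)
    (U : UnitLinearFrobeniusData F (powEnd Φ d)) [U.functor.IsEquivalence]
    (hη : OneCommutes U.functor (wideSubcategoryInclusion (divIn F (powEnd Φ d)) ⋙ F) F
      (ElemFrobenioid.frobenius Φ d))
    (h3 : IsFrobenioid
      (F ⋙ ElemFrobenioid.map (imageMonoidIso (powEnd Φ d) (powEnd_app_injective hF.isPreFrobenioid d)).hom)) :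
    IsFrobenioid (cdToElem F (powEnd Φ d)) := by
  obtain ⟨η⟩ := hη
  obtain ⟨ε⟩ := exists_compatIso hF.isPreFrobenioid d U η
  exact IsFrobenioid.of_isEquivalence_of_iso (cdToElem F (powEnd Φ d)) U.functor ε h3

/-- **Row P25-L09 `CdFrobenioid` DISCHARGED** (τ-free form, as typed).
[cite: MochizukiFrdI2008, Prop. 2.5(iii) p.49] -/
theorem cdFrobenioid_holds (d : ℕ+) : Literature.AlgebraicGeometry.Frobenioids.FrdI.P25.CdFrobenioid F d := by
  intro hS U hU hη
  haveI := hU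
  exact isFrobenioid_cdToElem_of_compat hS.isFrobenioid d U hη
    (IsFrobenioid.comp_map_of_iso _ hS.isFrobenioid)

/-- **Row P25-L00 `Assembly25iii` CLOSED**: the typer's proved assembly instantiated with rows P25-L07
(`psiUnitLinearData_holds`), P25-L08 (`psiEquivalence_holds`) and P25-L09 (`cdFrobenioid_holds`) — a
second kernel route to the landed `PreFrobenioid.UnitLinearFrobeniusExists` (p411338) and
`PreFrobenioid.CdIsFrobenioid` (p414682); recorded as an `example` (the gate's dedup forbids a named
restatement). [cite: MochizukiFrdI2008, Prop. 2.5(iii) p.49] -/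
example (d : ℕ+) :
    Literature.AlgebraicGeometry.Frobenioids.PreFrobenioid.UnitLinearFrobeniusExists F d ∧
      Literature.AlgebraicGeometry.Frobenioids.PreFrobenioid.CdIsFrobenioid F d :=
  assembly25iii F d (fun τ => psiUnitLinearData_holds τ d) (fun τ => psiEquivalence_holds τ d)
    (cdFrobenioid_holds d)

end FrdI.P25

end Literature.AlgebraicGeometry.Frobenioids
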